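import Summits.BirchSwinnertonDyer.BirchSwinnertonDyer.Theorems.ClassRecordThreeEulerHalvesAtThreeCartanTorusCubeCutPSLineSplit
import HarnessLib

/-!
# Crux 23422 line `cartan` v8′, stub (F2a), PRINCIPAL-SERIES half of the torus-cube cut — file PS-3c: stub (P3)
# `P_psNonsplitNormSharp` REDUCED to the mod-3 line by the MOD-9 LATTICE ARGUMENT (no group cohomology)

Seat `bsd-stepL-cartan-f2a` g0 (explicit unit, pen g44 AUTOFILL #2 row (3′); `--supports stmt-BirchSwinnertonDyer-23422 --as helper`).
`psNonsplitNormSharp_of_line`: for `q ≡ 1 (mod 3)`, given the mod-3 line `X_M ⊂ X` (`hline`), simplicity of `X_M/3X` (`hsimple`),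
`X = ℤx + X_M` for `x ∉ X_M` (`hcyc`), a `q`-element `U` with `Σ_U ρ(u) w_S = 0` (`hU`), and ONE vector `u₀ ∉ X_M` killed by
`1 + ρ(d₀) + ρ(d₀)²` for some `d₀` (`hcube`), there is `g` with `N_{T_C}(ρ(g)⁻¹ w_S) = m·w_C ⇒ 3^{ord₃(q−1)+2} ∤ m` and
`N_{T_s}(ρ(g) w_C) = m′·w_S ⇒ 3^{ord₃(q−1)} ∣ m′`. THE ARGUMENT (replacing the `H¹(G, St ⊗ 𝔽₃)` non-splitness of the paper proof):
with the transversal norm `N̄_C = c(·)·w_C` (`N_{T_C} = (q−1)·N̄_C`, file PS-3) suppose `9 ∣ c(ρ(h) w_S)` for all `h`; put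
`X_S = ℤ[G]w_S ⊆ X_M` (`w_S ∈ X_M`), so `X_S + 3X = X_M` by simplicity, and `S′ = X_S + 3X_M`. If `S′ = X_M` then
`X_M ⊆ X_S + 9X_M + …` gives `9 ∣ c(X_M) ∋ c(3w_C) = 3(q+1)`, absurd. Otherwise `3w_C ∉ S′`, `X = ℤw_C + S′`, `ρ(d₀)w_C ≡ e·w_C (mod S′)`
with `e ≡ 1 (mod 3)` (trivial action on `X/X_M`), `u₀ ≡ a·w_C` with `3 ∤ a`, and `0 = u₀ + ρ(d₀)u₀ + ρ(d₀)²u₀ ≡ a(1+e+e²)·w_C`; as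
`1 + e + e² = 3(1 + 3k + 3k²)`, Bézout with `9w_C ∈ S′` gives `3w_C ∈ S′` — contradiction.
HONEST FRAMING: a conditional reduction on one lattice; S-K1′ is NOT proved, no summit statement, no route item and no registered stub is
proved; BSD is proved for no curve. [folklore lattice argument, this seat]
-/

namespace Summit.BirchSwinnertonDyer.BirchSwinnertonDyer.Theorems.CartanTorusCubeCut.PS

open Summit.BirchSwinnertonDyer.BirchSwinnertonDyer.Theorems.CartanDegree
open Summit.BirchSwinnertonDyer.BirchSwinnertonDyer.Theorems.CartanTorusCubeCut

set_option linter.dupNamespace false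
set_option autoImplicit false

variable {q : ℕ} [Fact q.Prime]

section Aux
variable (𝓛 : CartanTorusLattice q)

omit [Fact q.Prime] in
/-- a generator of the saturated split-fixed line is not divisible by `3`. -/
theorem wS_not_three_smul {wS : Fin 𝓛.d → ℤ} (hwS : wS ≠ 0)
    (hSgen : ∀ v, 𝓛.IsSplitFixed v → ∃ m : ℤ, v = m • wS) (hS : 𝓛.IsSplitFixed wS) :
    ¬ ∃ w, wS = (3 : ℤ) • w := by
  rintro ⟨w, hw⟩
  have hwfix : 𝓛.IsSplitFixed w := by
    intro t h01 h10
    have := hS t h01 h10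
    rw [hw, map_zsmul] at this
    exact smul_right_injective _ (by norm_num : (3 : ℤ) ≠ 0) this
  obtain ⟨m, hm⟩ := hSgen w hwfix
  rw [hm, smul_smul] at hw
  have : (1 - 3 * m) • wS = 0 := by rw [sub_smul, one_smul, ← hw, sub_self]
  rcases smul_eq_zero.1 this with h | h
  · omega
  · exact hwS h

omit [Fact q.Prime] in
/-- Bézout in a submodule: `3z ∈ S` and `n z ∈ S` with `3 ∤ n` give `z ∈ S`. -/
theorem mem_of_three_smul_mem_of_smul_mem (S : Submodule ℤ (Fin 𝓛.d → ℤ)) {z : Fin 𝓛.d → ℤ} {n : ℤ}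
    (hn : ¬ (3 : ℤ) ∣ n) (h3 : (3 : ℤ) • z ∈ S) (hnz : n • z ∈ S) : z ∈ S := by
  obtain ⟨a, b, hab⟩ := isCoprime_three_of_not_dvd hn
  have : z = a • ((3 : ℤ) • z) + b • (n • z) := by
    rw [smul_smul, smul_smul, ← add_smul, hab, one_smul]
  rw [this]
  exact S.add_mem (S.smul_mem a h3) (S.smul_mem b hnz)

/-- `3^{v+2} ∣ N·c` with `v = ord₃ N`, `N ≠ 0` forces `9 ∣ c`. -/
theorem nine_dvd_of_pow_dvd_mul {N : ℕ} (hN : N ≠ 0) {c : ℤ}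
    (h : (3 : ℤ) ^ (padicValNat 3 N + 2) ∣ (N : ℤ) * c) : (9 : ℤ) ∣ c := by
  by_cases hc : c = 0
  · rw [hc]; exact dvd_zero 9
  haveI : Fact (Nat.Prime 3) := ⟨Nat.prime_three⟩
  have hNc : (N : ℤ) * c ≠ 0 := mul_ne_zero (by exact_mod_cast hN) hc
  have key := (padicValInt_dvd_iff (p := 3) (padicValNat 3 N + 2) ((N : ℤ) * c)).1 (by exact_mod_cast h)
  rcases key with h0 | hle
  · exact absurd h0 hNc
  · rw [padicValInt.mul (by exact_mod_cast hN) hc, padicValInt.of_nat] at hle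
    have h2 : 2 ≤ padicValInt 3 c := by omega
    have := (padicValInt_dvd_iff (p := 3) 2 c).2 (Or.inr h2)
    norm_num at this
    exact this

end Aux

/-! ### (P3) from the line -/

/-- **(P3) for the given lattice, from the mod-3 line** (`hline`, `hsimple`, `hcyc`), the unipotent relation `hU`, and one
cube relation `hcube` outside `X_M` — by the mod-9 lattice argument described in the module docstring. -/
theorem psNonsplitNormSharp_of_line (𝓛 : CartanTorusLattice q) (h1 : q % 3 = 1)
    {XM : Submodule ℤ (Fin 𝓛.d → ℤ)}
    (hline : (∀ g : G q, ∀ x ∈ XM, 𝓛.ρ g x ∈ XM) ∧ (∀ x, (3 : ℤ) • x ∈ XM) ∧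
      (∀ (g : G q) (x : Fin 𝓛.d → ℤ), 𝓛.ρ g x - x ∈ XM) ∧ XM ≠ ⊤)
    (hsimple : ∀ L : Submodule ℤ (Fin 𝓛.d → ℤ), (∀ g : G q, ∀ x ∈ L, 𝓛.ρ g x ∈ L) →
      (∀ x, (3 : ℤ) • x ∈ L) → L ≤ XM → (L = XM ∨ ∀ x ∈ L, ∃ y, x = (3 : ℤ) • y))
    (hcyc : ∀ x, x ∉ XM → ∀ y, ∃ a : ℤ, y - a • x ∈ XM)
    {wS wC : Fin 𝓛.d → ℤ}
    (hS : 𝓛.IsSplitFixed wS) (hSgen : ∀ v, 𝓛.IsSplitFixed v → ∃ m : ℤ, v = m • wS)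
    (hC : 𝓛.IsNonsplitFixed wC) (hCgen : ∀ v, 𝓛.IsNonsplitFixed v → ∃ m : ℤ, v = m • wC)
    (hU : ∃ U : Finset (G q), U.card = q ∧ ∑ u ∈ U, 𝓛.ρ u wS = 0)
    (hcube : ∃ (d₀ : G q) (u₀ : Fin 𝓛.d → ℤ), u₀ ∉ XM ∧ u₀ + 𝓛.ρ d₀ u₀ + 𝓛.ρ d₀ (𝓛.ρ d₀ u₀) = 0) :
    ∃ g : G q, (∀ m : ℤ, normOp 𝓛 (nonsplitTorus 𝓛.η) (𝓛.ρ g⁻¹ wS) = m • wC →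
        ¬ (3 : ℤ) ^ (padicValNat 3 (q - 1) + 2) ∣ m) ∧
      (∀ m : ℤ, normOp 𝓛 (splitTorus q) (𝓛.ρ g wC) = m • wS → (3 : ℤ) ^ padicValNat 3 (q - 1) ∣ m) := by
  classical
  have hq : q.Prime := Fact.out
  obtain ⟨hG, h3, htriv, hne⟩ := id hline
  have hwS : wS ≠ 0 := wS_ne_zero 𝓛 h1 hSgen
  have hwC : wC ≠ 0 := wC_ne_zero 𝓛 h1 hCgen
  have hwCM : wC ∉ XM := wC_not_mem 𝓛 hline h1 hCgen
  have hwSM : wS ∈ XM := wS_mem 𝓛 hline h1 hU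
  -- the transversal norm and its coefficient functional
  set Nb : (Fin 𝓛.d → ℤ) →ₗ[ℤ] (Fin 𝓛.d → ℤ) := 1 + ∑ a : ZMod q, 𝓛.ρ (linGL 𝓛.η 𝓛.η_irred (a, 1)) with hNb
  have hNbfix : ∀ x, ∃ m : ℤ, Nb x = m • wC := fun x => hCgen _ (isNonsplitFixed_nbar 𝓛 x)
  set c := coeffAlong 𝓛 Nb wC hNbfix hwC with hc_def
  have hc : ∀ x, Nb x = c x • wC := coeffAlong_spec 𝓛 Nb wC hNbfix hwC
  have hcwC : c wC = (q : ℤ) + 1 := by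
    have h := hc wC
    rw [hNb, nbar_wC 𝓛 hC] at h
    exact (smul_left_injective ℤ hwC h).symm
  have hc3wC : c ((3 : ℤ) • wC) = 3 * ((q : ℤ) + 1) := by rw [map_zsmul, smul_eq_mul, hcwC]
  -- KEY: some translate of `w_S` has transversal-norm coefficient not divisible by 9
  have key : ∃ h : G q, ¬ (9 : ℤ) ∣ c (𝓛.ρ h wS) := by
    by_contra hall
    push Not at hall
    -- `X_S = ℤ[G] w_S ⊆ X_M`, and `c(X_S) ⊆ 9ℤ`
    set XS : Submodule ℤ (Fin 𝓛.d → ℤ) := Submodule.span ℤ (Set.range fun h : G q => 𝓛.ρ h wS) with hXS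
    have hXS_M : XS ≤ XM := by
      rw [hXS, Submodule.span_le]; rintro _ ⟨h, rfl⟩; exact hG h _ hwSM
    have hXS9 : ∀ x ∈ XS, (9 : ℤ) ∣ c x := by
      have hle : XS ≤ (Submodule.span ℤ ({9} : Set ℤ)).comap c := by
        rw [hXS, Submodule.span_le]
        rintro _ ⟨h, rfl⟩
        rw [SetLike.mem_coe, Submodule.mem_comap]
        exact Ideal.mem_span_singleton.2 (hall h)
      intro x hx
      exact Ideal.mem_span_singleton.1 (hle hx)
    have hXSG : ∀ g : G q, ∀ x ∈ XS, 𝓛.ρ g x ∈ XS := fun g x hx => rho_mem_span_orbit 𝓛 wS g hx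
    -- `3X` and `3X_M`
    set T : Submodule ℤ (Fin 𝓛.d → ℤ) := LinearMap.range (LinearMap.lsmul ℤ (Fin 𝓛.d → ℤ) 3) with hT
    have memT : ∀ x : Fin 𝓛.d → ℤ, x ∈ T ↔ ∃ y, x = (3 : ℤ) • y := by
      intro x
      simp only [hT, LinearMap.mem_range, LinearMap.lsmul_apply]
      exact ⟨fun ⟨y, hy⟩ => ⟨y, hy.symm⟩, fun ⟨y, hy⟩ => ⟨y, hy.symm⟩⟩
    set T' : Submodule ℤ (Fin 𝓛.d → ℤ) := XM.map (LinearMap.lsmul ℤ (Fin 𝓛.d → ℤ) 3) with hT'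
    have memT' : ∀ x : Fin 𝓛.d → ℤ, x ∈ T' ↔ ∃ y ∈ XM, x = (3 : ℤ) • y := by
      intro x
      simp only [hT', Submodule.mem_map, LinearMap.lsmul_apply]
      exact ⟨fun ⟨y, hy, e⟩ => ⟨y, hy, e.symm⟩, fun ⟨y, hy, e⟩ => ⟨y, hy, e.symm⟩⟩
    have hT'3 : ∀ y ∈ XM, (3 : ℤ) • y ∈ T' := fun y hy => (memT' _).2 ⟨y, hy, rfl⟩
    -- `X_S + 3X = X_M` by simplicity
    have hXM : XS ⊔ T = XM := by
      rcases hsimple (XS ⊔ T)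
          (fun g x hx => by
            rw [Submodule.mem_sup] at hx
            obtain ⟨a, ha, t, ht, rfl⟩ := hx
            rw [map_add]
            refine Submodule.add_mem _ (Submodule.mem_sup_left (hXSG g a ha)) ?_
            obtain ⟨y, rfl⟩ := (memT t).1 ht
            rw [map_zsmul]
            exact Submodule.mem_sup_right ((memT _).2 ⟨_, rfl⟩))
          (fun x => Submodule.mem_sup_right ((memT _).2 ⟨x, rfl⟩))
          (sup_le hXS_M (fun t ht => by obtain ⟨y, rfl⟩ := (memT t).1 ht; exact h3 y)) with h | h
      · exact h
      · exfalso
        exact wS_not_three_smul 𝓛 hwS hSgen hS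
          (h wS (Submodule.mem_sup_left (self_mem_span_orbit 𝓛 wS)))
    -- `S′ = X_S + 3X_M`
    set S' : Submodule ℤ (Fin 𝓛.d → ℤ) := XS ⊔ T' with hS'
    have hS'_M : S' ≤ XM := sup_le hXS_M (fun t ht => by
      obtain ⟨y, hy, rfl⟩ := (memT' t).1 ht; exact XM.smul_mem _ hy)
    have hS'G : ∀ g : G q, ∀ x ∈ S', 𝓛.ρ g x ∈ S' := by
      intro g x hx
      rw [hS', Submodule.mem_sup] at hx
      obtain ⟨a, ha, t, ht, rfl⟩ := hx
      rw [map_add]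
      refine Submodule.add_mem _ (Submodule.mem_sup_left (hXSG g a ha)) ?_
      obtain ⟨y, hy, rfl⟩ := (memT' t).1 ht
      rw [map_zsmul]
      exact Submodule.mem_sup_right (hT'3 _ (hG g y hy))
    by_cases hA : S' = XM
    · -- Case A: `X_M = X_S + 3X_M` ⇒ `9 ∣ c(x)` for every `x ∈ X_M`
      have h9 : ∀ x ∈ XM, (9 : ℤ) ∣ c x := by
        intro x hx
        have hx' : x ∈ S' := by rw [hA]; exact hx
        rw [hS', Submodule.mem_sup] at hx'
        obtain ⟨s, hs, t, ht, rfl⟩ := hx'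
        obtain ⟨m₁, hm₁, rfl⟩ := (memT' t).1 ht
        have hm₁' : m₁ ∈ S' := by rw [hA]; exact hm₁
        rw [hS', Submodule.mem_sup] at hm₁'
        obtain ⟨s', hs', t', ht', rfl⟩ := hm₁'
        obtain ⟨m₂, hm₂, rfl⟩ := (memT' t').1 ht'
        rw [map_add, map_zsmul, map_add, map_zsmul]
        obtain ⟨k₁, hk₁⟩ := hXS9 s hs
        obtain ⟨k₂, hk₂⟩ := hXS9 s' hs'
        rw [hk₁, hk₂]
        exact ⟨k₁ + 3 * k₂ + c m₂, by ring⟩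
      have := h9 _ (h3 wC)
      rw [hc3wC] at this
      omega
    · -- Case B: `S′ ≠ X_M`
      -- (B1) `3 w_C ∉ S′`
      have h3wC : (3 : ℤ) • wC ∉ S' := by
        intro hmem
        apply hA
        refine le_antisymm hS'_M ?_
        rw [← hXM]
        refine sup_le le_sup_left fun t ht => ?_
        obtain ⟨y, rfl⟩ := (memT t).1 ht
        obtain ⟨a, ha⟩ := hcyc wC hwCM y
        have : (3 : ℤ) • y = a • ((3 : ℤ) • wC) + (3 : ℤ) • (y - a • wC) := by
          rw [smul_sub, smul_smul, smul_smul, mul_comm]; abel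
        rw [this]
        exact S'.add_mem (S'.smul_mem a hmem) (Submodule.mem_sup_right (hT'3 _ ha))
      -- decomposition `y = a·w_C + s`, `s ∈ S′`
      have hdec : ∀ y : Fin 𝓛.d → ℤ, ∃ (a : ℤ) (s : Fin 𝓛.d → ℤ), s ∈ S' ∧ y = a • wC + s := by
        intro y
        obtain ⟨a, ha⟩ := hcyc wC hwCM y
        have hy : y - a • wC ∈ XS ⊔ T := by rw [hXM]; exact ha
        rw [Submodule.mem_sup] at hy
        obtain ⟨s, hs, t, ht, hst⟩ := hy
        obtain ⟨y', rfl⟩ := (memT t).1 ht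
        obtain ⟨a', ha'⟩ := hcyc wC hwCM y'
        refine ⟨a + 3 * a', s + (3 : ℤ) • (y' - a' • wC), S'.add_mem (Submodule.mem_sup_left hs)
          (Submodule.mem_sup_right (hT'3 _ ha')), ?_⟩
        have e : y = a • wC + (s + (3 : ℤ) • y') := by rw [hst]; abel
        rw [e, add_smul, smul_sub, smul_smul]
        abel
      -- `ρ(d₀) w_C = e·w_C + s₁`, `e ≡ 1 (mod 3)`
      obtain ⟨d₀, u₀, hu₀M, hrel⟩ := hcube
      obtain ⟨e, s₁, hs₁, hes₁⟩ := hdec (𝓛.ρ d₀ wC)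
      have he : (3 : ℤ) ∣ e - 1 := by
        apply three_dvd_of_smul_wC_mem 𝓛 hline h1 hCgen
        have hm : 𝓛.ρ d₀ wC - wC ∈ XM := htriv d₀ wC
        rw [hes₁] at hm
        have : (e - 1) • wC = (e • wC + s₁ - wC) - s₁ := by rw [sub_smul, one_smul]; abel
        rw [this]
        exact XM.sub_mem hm (hS'_M hs₁)
      obtain ⟨k, hk⟩ := he
      -- `u₀ = a·w_C + s₀`, `3 ∤ a`
      obtain ⟨a, s₀, hs₀, has₀⟩ := hdec u₀
      have ha3 : ¬ (3 : ℤ) ∣ a := by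
        rintro ⟨a', rfl⟩
        apply hu₀M
        rw [has₀, mul_comm, ← smul_smul]
        exact XM.add_mem (XM.smul_mem a' (h3 wC)) (hS'_M hs₀)
      -- the relation modulo `S′`
      have hS'sub : ∀ x ∈ S', ∀ y ∈ S', x - y ∈ S' := fun x hx y hy => S'.sub_mem hx hy
      have hmem : (a * (1 + e + e * e)) • wC ∈ S' := by
        -- u₀ + ρ d₀ u₀ + ρ d₀ (ρ d₀ u₀) = a(1+e+e²) wC + (element of S′)
        have e1 : 𝓛.ρ d₀ u₀ = (a * e) • wC + (a • s₁ + 𝓛.ρ d₀ s₀) := by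
          rw [has₀, map_add, map_zsmul, hes₁, smul_add, smul_smul]; abel
        have e2 : 𝓛.ρ d₀ (𝓛.ρ d₀ u₀) = (a * e * e) • wC +
            ((a * e) • s₁ + 𝓛.ρ d₀ (a • s₁ + 𝓛.ρ d₀ s₀)) := by
          rw [e1, map_add, map_zsmul, hes₁, smul_add, smul_smul]; abel
        have hsum : (a * (1 + e + e * e)) • wC =
            -(s₀ + (a • s₁ + 𝓛.ρ d₀ s₀) + ((a * e) • s₁ + 𝓛.ρ d₀ (a • s₁ + 𝓛.ρ d₀ s₀))) := by
          have h0 := hrel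
          rw [e2, e1, has₀] at h0
          have : (a * (1 + e + e * e)) • wC = a • wC + (a * e) • wC + (a * e * e) • wC := by
            simp only [mul_add, mul_one, add_smul, mul_assoc]
          rw [this]
          rw [← sub_eq_zero]
          rw [← h0]
          abel
        rw [hsum]
        refine S'.neg_mem (S'.add_mem (S'.add_mem hs₀ ?_) ?_)
        · exact S'.add_mem (S'.smul_mem a hs₁) (hS'G d₀ _ hs₀)
        · exact S'.add_mem (S'.smul_mem _ hs₁) (hS'G d₀ _ (S'.add_mem (S'.smul_mem a hs₁) (hS'G d₀ _ hs₀)))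
      -- `1 + e + e² = 3(1 + 3k + 3k²)`
      have hfac : a * (1 + e + e * e) = (a * (1 + 3 * k + 3 * k * k)) * 3 := by
        have : e = 3 * k + 1 := by omega
        rw [this]; ring
      rw [hfac, ← smul_smul] at hmem
      have hn : ¬ (3 : ℤ) ∣ a * (1 + 3 * k + 3 * k * k) := by
        intro h
        rcases Int.prime_three.dvd_or_dvd h with h' | h'
        · exact ha3 h'
        · have : (3 : ℤ) ∣ 1 := by
            have e3 : (1 : ℤ) = (1 + 3 * k + 3 * k * k) - 3 * (k + k * k) := by ring
            rw [e3]; exact dvd_sub h' (dvd_mul_right 3 _)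
          omega
      have h9 : (3 : ℤ) • ((3 : ℤ) • wC) ∈ S' := Submodule.mem_sup_right (hT'3 _ (h3 wC))
      exact h3wC (mem_of_three_smul_mem_of_smul_mem 𝓛 S' hn h9 hmem)
  -- conclusion from KEY
  obtain ⟨h, hh⟩ := key
  refine ⟨h⁻¹, fun m hm => ?_, fun m hm => three_pow_dvd_coeff_normOp_splitTorus 𝓛 hwS hSgen _ m hm⟩
  rw [inv_inv, normOp_nonsplitTorus_eq, LinearMap.smul_apply] at hm
  change ((q - 1 : ℕ) : ℤ) • Nb (𝓛.ρ h wS) = m • wC at hm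
  rw [hc, smul_smul] at hm
  have hm' : ((q - 1 : ℕ) : ℤ) * c (𝓛.ρ h wS) = m := smul_left_injective ℤ hwC hm
  rw [← hm']
  intro hdiv
  have hq1 : q - 1 ≠ 0 := by have := hq.two_le; omega
  exact hh (nine_dvd_of_pow_dvd_mul hq1 hdiv)

end Summit.BirchSwinnertonDyer.BirchSwinnertonDyer.Theorems.CartanTorusCubeCut.PS
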